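import Mathlib
import Summits.Ventures.PercRepro2.Defs
import Summits.Ventures.PercRepro2.Graph
import Summits.Ventures.PercRepro2.OneColourSwitch
import Summits.Ventures.PercRepro2.RegionHubSign
import Summits.Ventures.PercRepro2.SideSwitch
import Summits.Ventures.PercRepro2.M9NoPocketDefs
import Summits.Ventures.PercRepro2.M9PocketRSEdgeTransfer
import Summits.Ventures.PercRepro2.M9PocketRootOnlyTransfer
import Summits.Ventures.PercRepro2.M9PocketRootOnlyPTransfer
import Summits.Ventures.PercRepro2.M9PocketRootOnlyPWorlds
import Summits.Ventures.PercRepro2.M9PocketRootOnlyPGlue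

/-!
# A cluster hanging from `{r, s, p}` — the glued colouring (blind cell PercRepro2, p3 g41,
2026-08-29; `proofs/P3-POCKETRK.md` §10⁵ (j))

A colouring of `G` is a colouring of the edges off `F` (`F` = the edges inside `L ∪ {r, s, p}`)
glued with a colouring `τ` of `F`; by `M9PocketRootOnlyPGlue` the glued colouring is `Sep ∧ DOne`
iff the restriction is and `τ` is ADMISSIBLE («`p` not `F`-joined to `r`, `s` in either colour,
no vertex of `L` other than `d` in both worlds of the `F`-graph»; `legal_glue_iff_p`), `σ_pq` is
that of the restriction (`sigma_pq_glue_eq_p`), `r ~_Y s` and `r ~_W s` are the disjunctions of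
the two links (`conn_rs_glue_iff_p`), and the admissibility is invariant under the colour flip
of `τ` (`admissible_compl_iff_p`).  Own work; std axioms.
-/

namespace Summit.Ventures.PercRepro2

namespace NoPocket

open Finset Classical OneColourSwitch SideSwitch

variable {V : Type*} {E : Type*} {ends : E → Sym2 V} {p q r s d : V} {L : Set V}

section LegalP

/-- **`Sep ∧ DOne` of the glued colouring**: `Sep ∧ DOne` of the restriction and the
admissibility of `τ`. -/
lemma legal_glue_iff_p (hL : ∀ e x y, ends e = s(x, y) → x ∈ L → y ∈ L ∨ y = r ∨ y = s ∨ y = p)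
    (hp : p ∉ L) (hq : q ∉ L) (hr : r ∉ L) (hs : s ∉ L)
    (ω' : {e // e ∉ within ends (L ∪ {r, s, p} : Set V)} → Bool)
    (τ : {e // ¬ (e ∉ within ends (L ∪ {r, s, p} : Set V))} → Bool) :
    (sep2 ends p q r s ((Equiv.piEquivPiSubtypeProd
        (fun e => e ∉ within ends (L ∪ {r, s, p} : Set V)) (fun _ => Bool)).symm (ω', τ)) ∧
      DOne ends r s d ((Equiv.piEquivPiSubtypeProd
        (fun e => e ∉ within ends (L ∪ {r, s, p} : Set V)) (fun _ => Bool)).symm (ω', τ))) ↔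
    ((sep2 (fun e : {e // e ∉ within ends (L ∪ {r, s, p} : Set V)} => ends e.1) p q r s ω' ∧
      DOne (fun e : {e // e ∉ within ends (L ∪ {r, s, p} : Set V)} => ends e.1) r s d ω') ∧
      ((¬ Conn (fun e : {e // ¬ (e ∉ within ends (L ∪ {r, s, p} : Set V))} => ends e.1) τ p r ∧
        ¬ Conn (fun e : {e // ¬ (e ∉ within ends (L ∪ {r, s, p} : Set V))} => ends e.1) τ p s ∧
        ¬ Conn (fun e : {e // ¬ (e ∉ within ends (L ∪ {r, s, p} : Set V))} => ends e.1)
          (OneColourSwitch.compl τ) p r ∧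
        ¬ Conn (fun e : {e // ¬ (e ∉ within ends (L ∪ {r, s, p} : Set V))} => ends e.1)
          (OneColourSwitch.compl τ) p s) ∧
      ∀ x ∈ L, x ≠ d →
        x ∈ K2 (fun e : {e // ¬ (e ∉ within ends (L ∪ {r, s, p} : Set V))} => ends e.1) r s τ →
        x ∉ M2 (fun e : {e // ¬ (e ∉ within ends (L ∪ {r, s, p} : Set V))} => ends e.1) r s τ)) := by
  have hr1 := restrict_glue_p (ends := ends) ω' τ
  have hr2 := restrictF_glue_p (ends := ends) ω' τ
  have hr3 := restrictF_compl_glue_p (ends := ends) ω' τ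
  constructor
  · rintro ⟨hsep, hD⟩
    -- the admissibility of `τ` in the `p`-part follows from `Sep`
    have h3 : ¬ Conn (fun e : {e // ¬ (e ∉ within ends (L ∪ {r, s, p} : Set V))} => ends e.1)
        τ p r := by
      rw [← hr2]; exact fun h => hsep.1.1 (conn_of_conn_restrict h)
    have h4 : ¬ Conn (fun e : {e // ¬ (e ∉ within ends (L ∪ {r, s, p} : Set V))} => ends e.1)
        τ p s := by
      rw [← hr2]; exact fun h => hsep.1.2.1 (conn_of_conn_restrict h)
    have h3' : ¬ Conn (fun e : {e // ¬ (e ∉ within ends (L ∪ {r, s, p} : Set V))} => ends e.1)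
        (OneColourSwitch.compl τ) p r := by
      rw [← hr3]; exact fun h => hsep.2.1 (conn_of_conn_restrict h)
    have h4' : ¬ Conn (fun e : {e // ¬ (e ∉ within ends (L ∪ {r, s, p} : Set V))} => ends e.1)
        (OneColourSwitch.compl τ) p s := by
      rw [← hr3]; exact fun h => hsep.2.2.1 (conn_of_conn_restrict h)
    have hsep' := (sep2_restrict_iff_p hL hp hq (by rw [hr2]; exact h3) (by rw [hr2]; exact h4)
      (by rw [hr3]; exact h3') (by rw [hr3]; exact h4')).1 hsep
    rw [hr1] at hsep'
    have hD' := (DOne_restrict_iff_p hL hr hs hsep (by rw [hr2]; exact h3) (by rw [hr2]; exact h4)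
      (by rw [hr3]; exact h3') (by rw [hr3]; exact h4')).1 hD
    rw [hr1, hr2] at hD'
    exact ⟨⟨hsep', hD'.1⟩, ⟨h3, h4, h3', h4'⟩, hD'.2⟩
  · rintro ⟨⟨hsep', hD'⟩, ⟨h3, h4, h3', h4'⟩, hA⟩
    have hsep := (sep2_restrict_iff_p hL hp hq (by rw [hr2]; exact h3) (by rw [hr2]; exact h4)
      (by rw [hr3]; exact h3') (by rw [hr3]; exact h4')).2 (by rw [hr1]; exact hsep')
    refine ⟨hsep, ?_⟩
    rw [DOne_restrict_iff_p hL hr hs hsep (by rw [hr2]; exact h3) (by rw [hr2]; exact h4)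
      (by rw [hr3]; exact h3') (by rw [hr3]; exact h4'), hr1, hr2]
    exact ⟨hD', hA⟩

/-- **`σ_pq` of the glued colouring** is that of the restriction, at a glued `Sep` point. -/
lemma sigma_pq_glue_eq_p (hL : ∀ e x y, ends e = s(x, y) → x ∈ L → y ∈ L ∨ y = r ∨ y = s ∨ y = p)
    (hp : p ∉ L) (hq : q ∉ L)
    (ω' : {e // e ∉ within ends (L ∪ {r, s, p} : Set V)} → Bool)
    (τ : {e // ¬ (e ∉ within ends (L ∪ {r, s, p} : Set V))} → Bool)
    (hsep : sep2 ends p q r s ((Equiv.piEquivPiSubtypeProd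
      (fun e => e ∉ within ends (L ∪ {r, s, p} : Set V)) (fun _ => Bool)).symm (ω', τ))) :
    sigma ends ((Equiv.piEquivPiSubtypeProd
        (fun e => e ∉ within ends (L ∪ {r, s, p} : Set V)) (fun _ => Bool)).symm (ω', τ)) p q =
      sigma (fun e : {e // e ∉ within ends (L ∪ {r, s, p} : Set V)} => ends e.1) ω' p q := by
  have hr2 := restrictF_glue_p (ends := ends) ω' τ
  have hr3 := restrictF_compl_glue_p (ends := ends) ω' τ
  rw [sigma_pq_restrict_eq_p hL hp hq hsep (fun h => hsep.1.1 (conn_of_conn_restrict h))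
    (fun h => hsep.1.2.1 (conn_of_conn_restrict h)) (fun h => hsep.2.1 (conn_of_conn_restrict h))
    (fun h => hsep.2.2.1 (conn_of_conn_restrict h)), restrict_glue_p]

/-- **`r ~_Y s` and `r ~_W s` at the glued colouring**, for a restriction satisfying `Sep` and
an admissible `τ`. -/
lemma conn_rs_glue_iff_p (hL : ∀ e x y, ends e = s(x, y) → x ∈ L → y ∈ L ∨ y = r ∨ y = s ∨ y = p)
    (hr : r ∉ L) (hs : s ∉ L)
    (ω' : {e // e ∉ within ends (L ∪ {r, s, p} : Set V)} → Bool)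
    (τ : {e // ¬ (e ∉ within ends (L ∪ {r, s, p} : Set V))} → Bool)
    (hsep' : sep2 (fun e : {e // e ∉ within ends (L ∪ {r, s, p} : Set V)} => ends e.1) p q r s ω')
    (h3 : ¬ Conn (fun e : {e // ¬ (e ∉ within ends (L ∪ {r, s, p} : Set V))} => ends e.1) τ p r)
    (h4 : ¬ Conn (fun e : {e // ¬ (e ∉ within ends (L ∪ {r, s, p} : Set V))} => ends e.1) τ p s)
    (h3' : ¬ Conn (fun e : {e // ¬ (e ∉ within ends (L ∪ {r, s, p} : Set V))} => ends e.1)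
      (OneColourSwitch.compl τ) p r)
    (h4' : ¬ Conn (fun e : {e // ¬ (e ∉ within ends (L ∪ {r, s, p} : Set V))} => ends e.1)
      (OneColourSwitch.compl τ) p s) :
    (Conn ends ((Equiv.piEquivPiSubtypeProd
        (fun e => e ∉ within ends (L ∪ {r, s, p} : Set V)) (fun _ => Bool)).symm (ω', τ)) r s ↔
      Conn (fun e : {e // e ∉ within ends (L ∪ {r, s, p} : Set V)} => ends e.1) ω' r s ∨
        Conn (fun e : {e // ¬ (e ∉ within ends (L ∪ {r, s, p} : Set V))} => ends e.1) τ r s) ∧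
    (Conn ends (OneColourSwitch.compl ((Equiv.piEquivPiSubtypeProd
        (fun e => e ∉ within ends (L ∪ {r, s, p} : Set V)) (fun _ => Bool)).symm (ω', τ))) r s ↔
      Conn (fun e : {e // e ∉ within ends (L ∪ {r, s, p} : Set V)} => ends e.1)
          (OneColourSwitch.compl ω') r s ∨
        Conn (fun e : {e // ¬ (e ∉ within ends (L ∪ {r, s, p} : Set V))} => ends e.1)
          (OneColourSwitch.compl τ) r s) := by
  have hr1 := restrict_glue_p (ends := ends) ω' τ
  have hr2 := restrictF_glue_p (ends := ends) ω' τ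
  obtain ⟨⟨hpr, hps, _, _⟩, ⟨hpr', hps', _, _⟩⟩ := hsep'
  constructor
  · rw [conn_rs_restrict_iff_p hL hr hs (by rw [hr1]; exact fun h => hpr (conn_symm h))
      (by rw [hr1]; exact fun h => hps (conn_symm h)) (by rw [hr2]; exact fun h => h3 (conn_symm h))
      (by rw [hr2]; exact fun h => h4 (conn_symm h)), hr1, hr2]
  · rw [compl_glue_p]
    have hr1' := restrict_glue_p (ends := ends) (OneColourSwitch.compl ω')
      (OneColourSwitch.compl τ)
    have hr2' := restrictF_glue_p (ends := ends) (OneColourSwitch.compl ω')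
      (OneColourSwitch.compl τ)
    rw [conn_rs_restrict_iff_p hL hr hs (by rw [hr1']; exact fun h => hpr' (conn_symm h))
      (by rw [hr1']; exact fun h => hps' (conn_symm h))
      (by rw [hr2']; exact fun h => h3' (conn_symm h))
      (by rw [hr2']; exact fun h => h4' (conn_symm h)), hr1', hr2']

/-- The admissibility of `τ` is invariant under the colour flip. -/
lemma admissible_compl_iff_p (τ : {e // ¬ (e ∉ within ends (L ∪ {r, s, p} : Set V))} → Bool) :
    ((¬ Conn (fun e : {e // ¬ (e ∉ within ends (L ∪ {r, s, p} : Set V))} => ends e.1)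
        (OneColourSwitch.compl τ) p r ∧
      ¬ Conn (fun e : {e // ¬ (e ∉ within ends (L ∪ {r, s, p} : Set V))} => ends e.1)
        (OneColourSwitch.compl τ) p s ∧
      ¬ Conn (fun e : {e // ¬ (e ∉ within ends (L ∪ {r, s, p} : Set V))} => ends e.1)
        (OneColourSwitch.compl (OneColourSwitch.compl τ)) p r ∧
      ¬ Conn (fun e : {e // ¬ (e ∉ within ends (L ∪ {r, s, p} : Set V))} => ends e.1)
        (OneColourSwitch.compl (OneColourSwitch.compl τ)) p s) ∧
      ∀ x ∈ L, x ≠ d →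
        x ∈ K2 (fun e : {e // ¬ (e ∉ within ends (L ∪ {r, s, p} : Set V))} => ends e.1) r s
          (OneColourSwitch.compl τ) →
        x ∉ M2 (fun e : {e // ¬ (e ∉ within ends (L ∪ {r, s, p} : Set V))} => ends e.1) r s
          (OneColourSwitch.compl τ)) ↔
    ((¬ Conn (fun e : {e // ¬ (e ∉ within ends (L ∪ {r, s, p} : Set V))} => ends e.1) τ p r ∧
      ¬ Conn (fun e : {e // ¬ (e ∉ within ends (L ∪ {r, s, p} : Set V))} => ends e.1) τ p s ∧
      ¬ Conn (fun e : {e // ¬ (e ∉ within ends (L ∪ {r, s, p} : Set V))} => ends e.1)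
        (OneColourSwitch.compl τ) p r ∧
      ¬ Conn (fun e : {e // ¬ (e ∉ within ends (L ∪ {r, s, p} : Set V))} => ends e.1)
        (OneColourSwitch.compl τ) p s) ∧
      ∀ x ∈ L, x ≠ d →
        x ∈ K2 (fun e : {e // ¬ (e ∉ within ends (L ∪ {r, s, p} : Set V))} => ends e.1) r s τ →
        x ∉ M2 (fun e : {e // ¬ (e ∉ within ends (L ∪ {r, s, p} : Set V))} => ends e.1) r s τ) := by
  simp only [OneColourSwitch.compl_compl, K2_compl, M2_compl]
  constructor
  · rintro ⟨⟨a, b, c, e⟩, h⟩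
    exact ⟨⟨c, e, a, b⟩, fun x hx hxd h1 h2 => h x hx hxd h2 h1⟩
  · rintro ⟨⟨a, b, c, e⟩, h⟩
    exact ⟨⟨c, e, a, b⟩, fun x hx hxd h1 h2 => h x hx hxd h2 h1⟩

end LegalP

end NoPocket

end Summit.Ventures.PercRepro2
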